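import Literature.NumberTheory.DiophantineApproximation.DilogHermitePadeRational
import Literature.NumberTheory.DiophantineApproximation.DilogHermitePadeSeries
import Literature.NumberTheory.DiophantineApproximation.DilogHermitePadePartialFractions
import HarnessLib

/-!
# The Hermite–Padé form at a rational point: `M^n S_n(M/N) = a^ℚ_n Li₂ + b^ℚ_n Li₁ + c^ℚ_n`

Topic `Literature/NumberTheory/DiophantineApproximation`. For the type-I Hermite–Padé form
`S_n(x) = ∑_{t ≥ 1} R_n(t) x^t` of `DilogHermitePade.lean` (`DilogPade.form`) and a rational point
`x = M/N` with `1 ≤ M`, `2M ≤ N`, we prove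

  `M^n S_n(M/N) = formAQ n N M · L₂(M/N) + formBQ n N M · L₁(M/N) + formCQ n N M`

(`DilogPade.pow_mul_form_eq_rat`), where `L_s = DilogPade.polylogSeries s` and
`formAQ = ∑_i A_{n,i} N^i M^{n−i}`, `formBQ = ∑_i B_{n,i} N^i M^{n−i}`,
`formCQ = −∑_i ∑_{k<i} N^k M^{n−k} (A_{n,i}/(i−k)² + B_{n,i}/(i−k))` are the cleared coefficients of
`DilogHermitePadeRational.lean`. This is the rational-point version of
`DilogPade.form_eq_of_partialFractions` (the case `M = 1`), with the partial fractions of the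
kernel now supplied by `DilogPade.kernel_succ_eq_partialFractions`.

* `form_eq_sum_coef_mul_tsum` — for `0 ≤ x < 1`, `S_n(x) = ∑_i (A_{n,i} T₂,ᵢ(x) + B_{n,i} T₁,ᵢ(x))`
  with `T_{s,i}(x) = ∑_{t ≥ 0} x^{t+1}/(t+1+i)^s` (partial fractions + exchange of sums);
* `pow_mul_form_eq_rat` — the identity above.

The computation: with `x = M/N` one has `N^j x^j = M^j`, so
`M^n T_{s,i}(x) = N^i M^{n−i} (L_s(x) − ∑_{k<i} x^{k+1}/(k+1)^s)` for `i ≤ n`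
(`DilogPade.pow_mul_tsum_shift`), and in the finite remainder
`N^i M^{n−i} x^{k+1} = N^{i−1−k} M^{n−(i−1−k)}`; the substitution `k ↦ i − 1 − k` produces the
double sum defining `formCQ`.

References: S. David, N. Hirata-Kohno, M. Kawashima, *Can polylogarithms at algebraic points be
linearly independent?*, Moscow J. Comb. Number Th. 9 (2020), Thm 2.1; M. Hata, *On the linear
independence of the values of polylogarithmic functions*, J. Math. Pures Appl. 69 (1990).
Everything here is PROVED from Mathlib's `tsum` API and the sibling files; no definitions, no named
facts.
-/

noncomputable section

open Finset

namespace Literature.NumberTheory.DiophantineApproximation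

namespace DilogPade

/-- **Partial fraction expansion of the form.** For `0 ≤ x < 1`,
`S_n(x) = ∑_{i=0}^{n} (A_{n,i} ∑_{t ≥ 0} x^{t+1}/(t+1+i)² + B_{n,i} ∑_{t ≥ 0} x^{t+1}/(t+1+i))`:
expand the kernel `R_n(t+1)` into partial fractions (`kernel_succ_eq_partialFractions`) and
exchange the (absolutely convergent) series with the finite sum.
[cite: DavidHirataKohnoKawashima2020, Thm 2.1] -/
theorem form_eq_sum_coef_mul_tsum (n : ℕ) {x : ℝ} (hx : 0 ≤ x) (hx1 : x < 1) :
    form n x = ∑ i ∈ Finset.range (n + 1),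
      ((coefA n i : ℝ) * ∑' t : ℕ, x ^ (t + 1) / ((t : ℝ) + 1 + i) ^ 2 +
        ((coefB n i : ℚ) : ℝ) * ∑' t : ℕ, x ^ (t + 1) / ((t : ℝ) + 1 + i) ^ 1) := by
  have hS : ∀ s i : ℕ, Summable fun t : ℕ => x ^ (t + 1) / ((t : ℝ) + 1 + i) ^ s :=
    fun s i => summable_pow_div_shift s i hx hx1
  have hterm : ∀ t : ℕ, kernel n ((t : ℝ) + 1) * x ^ (t + 1) =
      ∑ i ∈ range (n + 1), ((coefA n i : ℝ) * (x ^ (t + 1) / ((t : ℝ) + 1 + i) ^ 2) +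
        ((coefB n i : ℚ) : ℝ) * (x ^ (t + 1) / ((t : ℝ) + 1 + i) ^ 1)) := by
    intro t
    rw [kernel_succ_eq_partialFractions n t, Finset.sum_mul]
    refine Finset.sum_congr rfl fun i _ => ?_
    rw [pow_one]
    ring
  rw [form, tsum_congr hterm, Summable.tsum_finsetSum fun i _ =>
    ((hS 2 i).mul_left (coefA n i : ℝ)).add ((hS 1 i).mul_left ((coefB n i : ℚ) : ℝ))]
  refine Finset.sum_congr rfl fun i _ => ?_
  rw [((hS 2 i).mul_left (coefA n i : ℝ)).tsum_add ((hS 1 i).mul_left ((coefB n i : ℚ) : ℝ)),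
    tsum_mul_left, tsum_mul_left]

/-- **The Hermite–Padé form at a rational point `x = M/N`** (David–Hirata-Kohno–Kawashima 2020,
the computation behind Thm 2.1; Hata 1990). For natural numbers `1 ≤ M` and `2M ≤ N`,
`M^n S_n(M/N) = a^ℚ_n · L₂(M/N) + b^ℚ_n · L₁(M/N) + c^ℚ_n`
with `a^ℚ_n = formAQ n N M = ∑_i A_{n,i} N^i M^{n−i}`,
`b^ℚ_n = formBQ n N M = ∑_i B_{n,i} N^i M^{n−i}`,
`c^ℚ_n = formCQ n N M = −∑_i ∑_{k<i} N^k M^{n−k} (A_{n,i}/(i−k)² + B_{n,i}/(i−k))` and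
`L_s = polylogSeries s`. [cite: DavidHirataKohnoKawashima2020, Thm 2.1] -/
theorem pow_mul_form_eq_rat {n N M : ℕ} (hM : 1 ≤ M) (hMN : 2 * M ≤ N) :
    (M : ℝ) ^ n * form n ((M : ℝ) / N) =
      (formAQ n N M : ℝ) * polylogSeries 2 ((M : ℝ) / N) +
        ((formBQ n N M : ℚ) : ℝ) * polylogSeries 1 ((M : ℝ) / N) + ((formCQ n N M : ℚ) : ℝ) := by
  have hNpos : (0 : ℝ) < N := Nat.cast_pos.mpr (by omega)
  have hN0 : (N : ℝ) ≠ 0 := hNpos.ne'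
  set x : ℝ := (M : ℝ) / N with hx
  have hx0 : 0 ≤ x := by positivity
  have hx1 : x < 1 := by
    rw [hx, div_lt_one hNpos]
    exact_mod_cast (by omega : M < N)
  have hNx : ∀ j : ℕ, (N : ℝ) ^ j * x ^ j = (M : ℝ) ^ j := fun j => by
    rw [← mul_pow, hx, mul_div_cancel₀ _ hN0]
  -- the shift identity, multiplied by `M^n = M^{n-i} · N^i x^i`
  have hg : ∀ s : ℕ, ∀ i ∈ range (n + 1),
      (M : ℝ) ^ n * ∑' t : ℕ, x ^ (t + 1) / ((t : ℝ) + 1 + i) ^ s =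
        (N : ℝ) ^ i * (M : ℝ) ^ (n - i) *
          (polylogSeries s x - ∑ k ∈ range i, x ^ (k + 1) / ((k : ℝ) + 1) ^ s) := by
    intro s i hi
    have hin : i ≤ n := by have := mem_range.mp hi; omega
    have hMn : (M : ℝ) ^ n = (M : ℝ) ^ (n - i) * ((N : ℝ) ^ i * x ^ i) := by
      rw [hNx, ← pow_add, Nat.sub_add_cancel hin]
    rw [hMn, ← pow_mul_tsum_shift s i hx0 hx1]
    ring
  -- Step 1: partial fractions; Step 2: the shift identity and the reflection `k ↦ i - 1 - k`.
  have key : ∀ i ∈ range (n + 1),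
      (M : ℝ) ^ n * ((coefA n i : ℝ) * ∑' t : ℕ, x ^ (t + 1) / ((t : ℝ) + 1 + i) ^ 2 +
        ((coefB n i : ℚ) : ℝ) * ∑' t : ℕ, x ^ (t + 1) / ((t : ℝ) + 1 + i) ^ 1) =
      (coefA n i : ℝ) * (N : ℝ) ^ i * (M : ℝ) ^ (n - i) * polylogSeries 2 x +
        ((coefB n i : ℚ) : ℝ) * (N : ℝ) ^ i * (M : ℝ) ^ (n - i) * polylogSeries 1 x -
        ∑ k ∈ range i, (N : ℝ) ^ k * (M : ℝ) ^ (n - k) *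
          ((coefA n i : ℝ) / ((i : ℝ) - k) ^ 2 + ((coefB n i : ℚ) : ℝ) / ((i : ℝ) - k)) := by
    intro i hi
    have hin : i ≤ n := by have := mem_range.mp hi; omega
    have hQ : (N : ℝ) ^ i * (M : ℝ) ^ (n - i) *
        ((coefA n i : ℝ) * ∑ k ∈ range i, x ^ (k + 1) / ((k : ℝ) + 1) ^ 2 +
          ((coefB n i : ℚ) : ℝ) * ∑ k ∈ range i, x ^ (k + 1) / ((k : ℝ) + 1) ^ 1) =
        ∑ k ∈ range i, (N : ℝ) ^ k * (M : ℝ) ^ (n - k) *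
          ((coefA n i : ℝ) / ((i : ℝ) - k) ^ 2 + ((coefB n i : ℚ) : ℝ) / ((i : ℝ) - k)) := by
      rw [Finset.mul_sum, Finset.mul_sum, ← Finset.sum_add_distrib, Finset.mul_sum,
        ← Finset.sum_range_reflect _ i]
      refine Finset.sum_congr rfl fun j hj => ?_
      obtain ⟨d, rfl⟩ : ∃ d, i = j + 1 + d :=
        ⟨i - (j + 1), by have := Finset.mem_range.mp hj; omega⟩
      have hcast : ((j + 1 + d : ℕ) : ℝ) - j = (d : ℝ) + 1 := by
        push_cast
        ring
      have hpow : (N : ℝ) ^ (j + 1 + d) * (M : ℝ) ^ (n - (j + 1 + d)) * x ^ (d + 1) =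
          (N : ℝ) ^ j * (M : ℝ) ^ (n - j) := by
        have hN' : (N : ℝ) ^ (j + 1 + d) = (N : ℝ) ^ j * (N : ℝ) ^ (d + 1) := by
          rw [← pow_add, add_assoc, add_comm 1 d]
        have hM' : (M : ℝ) ^ (n - j) = (M : ℝ) ^ (n - (j + 1 + d)) * (M : ℝ) ^ (d + 1) := by
          rw [← pow_add]
          congr 1
          omega
        rw [hN', hM', ← hNx (d + 1)]
        ring
      rw [show j + 1 + d - 1 - j = d by omega, hcast, ← hpow]
      ring
    have hmul : (M : ℝ) ^ n * ((coefA n i : ℝ) * ∑' t : ℕ, x ^ (t + 1) / ((t : ℝ) + 1 + i) ^ 2 +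
        ((coefB n i : ℚ) : ℝ) * ∑' t : ℕ, x ^ (t + 1) / ((t : ℝ) + 1 + i) ^ 1) =
        (coefA n i : ℝ) * ((M : ℝ) ^ n * ∑' t : ℕ, x ^ (t + 1) / ((t : ℝ) + 1 + i) ^ 2) +
          ((coefB n i : ℚ) : ℝ) *
            ((M : ℝ) ^ n * ∑' t : ℕ, x ^ (t + 1) / ((t : ℝ) + 1 + i) ^ 1) := by
      ring
    rw [hmul, hg 2 i hi, hg 1 i hi]
    linear_combination -hQ
  rw [form_eq_sum_coef_mul_tsum n hx0 hx1, Finset.mul_sum, Finset.sum_congr rfl key,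
    Finset.sum_sub_distrib, Finset.sum_add_distrib, ← Finset.sum_mul, ← Finset.sum_mul]
  -- Step 3: identify the three coefficients.
  have hA : ((formAQ n N M : ℤ) : ℝ) =
      ∑ i ∈ range (n + 1), (coefA n i : ℝ) * (N : ℝ) ^ i * (M : ℝ) ^ (n - i) := by
    push_cast [formAQ]
    rfl
  have hB : ((formBQ n N M : ℚ) : ℝ) =
      ∑ i ∈ range (n + 1), ((coefB n i : ℚ) : ℝ) * (N : ℝ) ^ i * (M : ℝ) ^ (n - i) := by
    push_cast [formBQ]
    rfl
  have hC : ((formCQ n N M : ℚ) : ℝ) =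
      -∑ i ∈ range (n + 1), ∑ k ∈ range i, (N : ℝ) ^ k * (M : ℝ) ^ (n - k) *
        ((coefA n i : ℝ) / ((i : ℝ) - k) ^ 2 + ((coefB n i : ℚ) : ℝ) / ((i : ℝ) - k)) := by
    push_cast [formCQ]
    rfl
  rw [hA, hB, hC]
  ring

end DilogPade

end Literature.NumberTheory.DiophantineApproximation
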